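import Literature.AlgebraicGeometry.Resolution.RetractionBlowupTransform
import HarnessLib

/-!
# Crux `PatchingRelPerfect` (stmt-ResolutionOfSingularities-16161), chain w52 — R4 support:
# the retraction-model transform law for MIXED weights with MONOMIAL contact

[OURS · L1 W5.2 · rung tool] res-L1-w52-plan-1 g6 KERNEL NOTE v1.6 (STATUS 2026-08-27T05:26:19Z): «in the
retraction model `K = r^*𝔟 ⊔ N·𝓘_E^ℓ` is STABLE under every weight-`ν ≤ ℓ` step along regular `C ⊂ E` with
`𝔟 ≤ C^ν` (sum rule for controlled transforms of `w^ν`-divisible summands)». The tree's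
`Resolution/RetractionBlowupTransform.lean` proves the PURE case `N = ⊤`, `ν = ℓ = b`
(`IsBlowup.comap_controlledTransform_retract(_of_isRegular)`); this file proves the mixed case by the same
cancellation, in the same setting (`k : W ⟶ X` a closed immersion with retraction `r`, `k ≫ r = 𝟙 W`; centre
`C ⊇ ker k`; blow-ups `π` along `C`, `ρ` along `C|_W`; `U = retractLiftOpen π C k r`, `r' = retractLift`):
* `comap_retract_sup_mul_ker_pow_le` — the mixed model is weight-`ν` permissible: `𝔟 ≤ (C|_W)^ν`, `ν ≤ ℓ` ⇒
  `r^*𝔟 ⊔ N·(ker k)^ℓ ≤ C^ν` (the X-side hypothesis of the host-format step `DepthOne.dictionaryStep_mixed`,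
  p502493, DISCHARGED in the model);
* **`comap_controlledTransform_retract_mixed` — the mixed transform law**:
  `σᶜ_π(r^*𝔟 ⊔ N·(ker k)^ℓ, ν)|_U = r'^*σᶜ_ρ(𝔟, ν) ⊔ (π^*N · 𝓘(exc)^{ℓ-ν} · (π^*(ker k) : 𝓘(exc))^ℓ)|_U`
  (no regularity hypothesis), and its regular form `comap_controlledTransform_retract_mixed_of_isRegular` with
  `(π^*(ker k) : 𝓘(exc))|_U = ker j'` the ideal of the strict transform `W' ↪ U`: the model
  `r^*𝔟 ⊔ N·𝓘_W^ℓ` on `(X ⊇ W)` transforms into the model `r'^*𝔟' ⊔ N'·𝓘_{W'}^ℓ` on `(U ⊇ W')` with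
  `𝔟' = σᶜ_ρ(𝔟, ν)` and the NEW MONOMIAL `N' = (π^*N · 𝓘(exc)^{ℓ-ν})|_U`;
* `mul_pow_controlledTransform_ker_le_mixed` — on all of `X'`: `π^*N · 𝓘(exc)^{ℓ-ν} · (π^*(ker k) : 𝓘(exc))^ℓ ≤
  σᶜ_π(r^*𝔟 ⊔ N·(ker k)^ℓ, ν)` (monomial contact persists globally; cf. `DepthOne.dictionaryStep_mixed`).
For `N = ⊤`, `ν = ℓ` these are the tree's statements. Fact-free; elementary consequences of BGMW Lemma 3.2.1 and
GW Prop. 13.91, not printed in this form. Nothing here is a statement of the manuscript under review.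

## References
* U. Görtz, T. Wedhorn, *Algebraic Geometry I*, 2nd ed. (2020), Def. 13.90, Prop. 13.91, Prop. 13.96. [GortzWedhorn2020]
* E. Bierstone, D. Grigoriev, P. Milman, J. Włodarczyk, *Effective Hironaka resolution and its complexity*,
  Asian J. Math. 15 (2011), §3.2 Lemma 3.2.1, §4 Remark (3). [BierstoneGrigorievMilmanWlodarczyk2011]
-/

-- `Summit.<Summit>.<Sub>.Theorems` with `Sub = Summit` (single-conjunct summit, D-0017)
set_option linter.dupNamespace false

noncomputable section

open CategoryTheory CategoryTheory.Limits AlgebraicGeometry TopologicalSpace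
open Literature.AlgebraicGeometry.Resolution

namespace Summit.ResolutionOfSingularities.ResolutionOfSingularities.Theorems

namespace RetractionMixed

universe u

variable {X X' W W' : Scheme.{u}} {k : W ⟶ X} [IsClosedImmersion k] {r : X ⟶ W} {C : X.IdealSheafData}
  {π : X' ⟶ X} {ρ : W' ⟶ W}

/-- **The mixed model is weight-`ν` permissible**: `𝔟 ≤ (C|_W)^ν` and `ν ≤ ℓ` give
`r^*𝔟 ⊔ N·(ker k)^ℓ ≤ C^ν` (`r^*(C|_W) ≤ C` by the splitting `C = ker k ⊔ r^*(C|_W)`, `ker k ≤ C`, `N ≤ ⊤`).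
[cite: GortzWedhorn2020, (4.11) with (4.11.1), p. 112] -/
theorem comap_retract_sup_mul_ker_pow_le (hkr : k ≫ r = 𝟙 W) (hCk : k.ker ≤ C) (N : X.IdealSheafData)
    {𝔟 : W.IdealSheafData} {ℓ ν : ℕ} (hνℓ : ν ≤ ℓ) (h𝔟 : 𝔟 ≤ C.comap k ^ ν) :
    𝔟.comap r ⊔ N * k.ker ^ ℓ ≤ C ^ ν := by
  have hrC : C.comap (r ≫ k) ≤ C := le_sup_right.trans_eq (ker_sup_comap_retract_eq hkr hCk)
  refine sup_le ?_ ?_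
  · calc 𝔟.comap r ≤ (C.comap k ^ ν).comap r := Scheme.IdealSheafData.comap_mono _ h𝔟
      _ = C.comap (r ≫ k) ^ ν := by rw [comap_pow, ← Scheme.IdealSheafData.comap_comp]
      _ ≤ C ^ ν := pow_le_pow_left' hrC ν
  · calc N * k.ker ^ ℓ ≤ k.ker ^ ℓ := mul_le_of_le_one_left bot_le le_top
      _ ≤ C ^ ℓ := pow_le_pow_left' hCk ℓ
      _ ≤ C ^ ν := pow_le_pow_right_of_le_one' le_top hνℓ

/-- **The mixed transform law for the retraction model** (no regularity hypothesis): for `𝔟 ≤ (C|_W)^ν`, `ν ≤ ℓ`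
and any ideal sheaf `N` on `X`,
`σᶜ_π(r^*𝔟 ⊔ N·(ker k)^ℓ, ν)|_U = r'^*σᶜ_ρ(𝔟, ν) ⊔ (π^*N · 𝓘(exc)^{ℓ-ν} · (π^*(ker k) : 𝓘(exc))^ℓ)|_U`. Proof: both
sides times the effective Cartier divisor `𝓘(exc)^ν|_U` equal `π^*(r^*𝔟 ⊔ N·(ker k)^ℓ)|_U`, using
`r'^*𝓘(exc_W) = 𝓘(exc)|_U`, `π^*(ker k) = 𝓘(exc)·(π^*(ker k) : 𝓘(exc))` and BGMW Lemma 3.2.1; cancel.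
[cite: BierstoneGrigorievMilmanWlodarczyk2011, §3.2 Lemma 3.2.1] [cite: GortzWedhorn2020, Prop. 13.91 (1), p. 413] -/
theorem comap_controlledTransform_retract_mixed (hπ : IsBlowup π C) (hρ : IsBlowup ρ (C.comap k))
    (hkr : k ≫ r = 𝟙 W) (hCk : k.ker ≤ C) (N : X.IdealSheafData) {𝔟 : W.IdealSheafData} {ℓ ν : ℕ}
    (hνℓ : ν ≤ ℓ) (h𝔟 : 𝔟 ≤ C.comap k ^ ν) :
    (controlledTransform π C (𝔟.comap r ⊔ N * k.ker ^ ℓ) ν).comap (retractLiftOpen π C k r).ι =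
      (controlledTransform ρ (C.comap k) 𝔟 ν).comap (hπ.retractLift hρ hkr hCk) ⊔
        (N.comap π * C.comap π ^ (ℓ - ν) * controlledTransform π C k.ker 1 ^ ℓ).comap
          (retractLiftOpen π C k r).ι := by
  set U := retractLiftOpen π C k r with hU
  have hJle : (𝔟.comap r ⊔ N * k.ker ^ ℓ).comap π ≤ C.comap π ^ ν :=
    (Scheme.IdealSheafData.comap_mono _ (comap_retract_sup_mul_ker_pow_le hkr hCk N hνℓ h𝔟)).trans_eq
      (comap_pow π C ν)
  have hJπ : C.comap π ^ ν * controlledTransform π C (𝔟.comap r ⊔ N * k.ker ^ ℓ) ν =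
      (𝔟.comap r ⊔ N * k.ker ^ ℓ).comap π := hπ.pow_mul_controlledTransform_eq hJle
  have h𝔟ρ : (C.comap k).comap ρ ^ ν * controlledTransform ρ (C.comap k) 𝔟 ν = 𝔟.comap ρ :=
    hρ.pow_mul_controlledTransform_eq ((Scheme.IdealSheafData.comap_mono _ h𝔟).trans_eq (comap_pow ρ _ ν))
  -- first summand: `π^*r^*𝔟 |_U = 𝓘(exc)^ν|_U · r'^*σᶜ_ρ(𝔟, ν)`
  have hA : ((𝔟.comap r).comap π).comap U.ι =
      (C.comap π).comap U.ι ^ ν * (controlledTransform ρ (C.comap k) 𝔟 ν).comap (hπ.retractLift hρ hkr hCk) := by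
    rw [← Scheme.IdealSheafData.comap_comp, ← Scheme.IdealSheafData.comap_comp, Category.assoc,
      ← hπ.retractLift_comp hρ hkr hCk, Scheme.IdealSheafData.comap_comp, ← h𝔟ρ, comap_mul, comap_pow,
      hπ.comap_exceptional_retractLift hρ hkr hCk]
  -- second summand: `π^*(N·(ker k)^ℓ) = 𝓘(exc)^ν · (π^*N · 𝓘(exc)^{ℓ-ν} · (π^*(ker k) : 𝓘(exc))^ℓ)`
  have hpow : C.comap π ^ ν * C.comap π ^ (ℓ - ν) = C.comap π ^ ℓ := by
    rw [← pow_add, Nat.add_sub_cancel' hνℓ]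
  have hB0 : (N * k.ker ^ ℓ).comap π =
      C.comap π ^ ν * (N.comap π * C.comap π ^ (ℓ - ν) * controlledTransform π C k.ker 1 ^ ℓ) := by
    calc (N * k.ker ^ ℓ).comap π = N.comap π * (C.comap π * controlledTransform π C k.ker 1) ^ ℓ := by
          rw [comap_mul, comap_pow, hπ.comap_mul_controlledTransform_one hCk]
      _ = N.comap π * ((C.comap π ^ ν * C.comap π ^ (ℓ - ν)) * controlledTransform π C k.ker 1 ^ ℓ) := by
          rw [mul_pow, hpow]
      _ = C.comap π ^ ν * (N.comap π * C.comap π ^ (ℓ - ν) * controlledTransform π C k.ker 1 ^ ℓ) := by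
          simp only [mul_left_comm, mul_assoc, mul_comm]
  have hB : ((N * k.ker ^ ℓ).comap π).comap U.ι =
      (C.comap π).comap U.ι ^ ν *
        (N.comap π * C.comap π ^ (ℓ - ν) * controlledTransform π C k.ker 1 ^ ℓ).comap U.ι := by
    rw [hB0, comap_mul, comap_pow]
  apply ((hπ.isEffectiveCartier.comap_ι U).pow ν).eq_of_mul_eq_mul
  rw [Scheme.IdealSheafData.mul_inf, ← hA, ← hB, ← comap_pow, ← comap_mul, hJπ,
    Scheme.IdealSheafData.comap_sup, Scheme.IdealSheafData.comap_sup]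

/-- **Monomial contact persists on all of `X'`**: `π^*N · 𝓘(exc)^{ℓ-ν} · (π^*(ker k) : 𝓘(exc))^ℓ ≤
σᶜ_π(r^*𝔟 ⊔ N·(ker k)^ℓ, ν)` (`N·(ker k)^ℓ` lies in the model; transform and cancel `𝓘(exc)^ν`).
[cite: BierstoneGrigorievMilmanWlodarczyk2011, §3.2 Lemma 3.2.1] -/
theorem mul_pow_controlledTransform_ker_le_mixed (hπ : IsBlowup π C) (hkr : k ≫ r = 𝟙 W) (hCk : k.ker ≤ C)
    (N : X.IdealSheafData) {𝔟 : W.IdealSheafData} {ℓ ν : ℕ} (hνℓ : ν ≤ ℓ) (h𝔟 : 𝔟 ≤ C.comap k ^ ν) :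
    N.comap π * C.comap π ^ (ℓ - ν) * controlledTransform π C k.ker 1 ^ ℓ ≤
      controlledTransform π C (𝔟.comap r ⊔ N * k.ker ^ ℓ) ν := by
  have hJle : (𝔟.comap r ⊔ N * k.ker ^ ℓ).comap π ≤ C.comap π ^ ν :=
    (Scheme.IdealSheafData.comap_mono _ (comap_retract_sup_mul_ker_pow_le hkr hCk N hνℓ h𝔟)).trans_eq
      (comap_pow π C ν)
  apply (hπ.isEffectiveCartier.pow ν).le_of_mul_le_mul
  have hpow : C.comap π ^ ν * C.comap π ^ (ℓ - ν) = C.comap π ^ ℓ := by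
    rw [← pow_add, Nat.add_sub_cancel' hνℓ]
  rw [hπ.pow_mul_controlledTransform_eq hJle]
  calc C.comap π ^ ν * (N.comap π * C.comap π ^ (ℓ - ν) * controlledTransform π C k.ker 1 ^ ℓ)
      = N.comap π * ((C.comap π ^ ν * C.comap π ^ (ℓ - ν)) * controlledTransform π C k.ker 1 ^ ℓ) := by
        simp only [mul_left_comm, mul_assoc, mul_comm]
    _ = N.comap π * (C.comap π * controlledTransform π C k.ker 1) ^ ℓ := by rw [hpow, mul_pow]
    _ = (N * k.ker ^ ℓ).comap π := by rw [hπ.comap_mul_controlledTransform_one hCk, comap_mul, comap_pow]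
    _ ≤ (𝔟.comap r ⊔ N * k.ker ^ ℓ).comap π := Scheme.IdealSheafData.comap_mono _ le_sup_right

end RetractionMixed

namespace RetractionMixed

universe u

variable {X X' W W' : Scheme.{u}} [IsLocallyNoetherian X] {k : W ⟶ X} [IsClosedImmersion k] {r : X ⟶ W}
  {C : X.IdealSheafData} {π : X' ⟶ X} {ρ : W' ⟶ W}

/-- **The mixed transform law, regular case**: `X` regular locally Noetherian, `V(C)` and `W` regular; then on `U`
`σᶜ_π(r^*𝔟 ⊔ N·𝓘_W^ℓ, ν)|_U = r'^*σᶜ_ρ(𝔟, ν) ⊔ (π^*N · 𝓘(exc)^{ℓ-ν} · 𝓘_{W'}^ℓ)|_U` with `𝓘_{W'} = ker Bl_C(k)` the ideal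
of the strict transform (`ker Bl_C(k) = (π^*𝓘_W : 𝓘(exc))`, `IsBlowup.ker_strictTransformHom_of_isRegular`; on `U` it is
`ker j'`, `IsBlowup.ker_strictTransformHomRes`): the
model `r^*𝔟 ⊔ N·𝓘_W^ℓ` on `(X ⊇ W)` becomes the model `r'^*𝔟' ⊔ N'·𝓘_{W'}^ℓ` on `(U ⊇ W')`, `𝔟' = σᶜ_ρ(𝔟, ν)`,
`N' = (π^*N · 𝓘(exc)^{ℓ-ν})|_U`. [cite: BierstoneGrigorievMilmanWlodarczyk2011, §4 Remark (3) with §3.2 Lemma 3.2.1]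
[cite: GortzWedhorn2020, Prop. 13.91 (1), p. 413] -/
theorem comap_controlledTransform_retract_mixed_of_isRegular (hX : Scheme.IsRegular X) (hπ : IsBlowup π C)
    (hρ : IsBlowup ρ (C.comap k)) (hkr : k ≫ r = 𝟙 W) (hCk : k.ker ≤ C) (hC : Scheme.IsRegular C.subscheme)
    (hW : Scheme.IsRegular k.ker.subscheme) (N : X.IdealSheafData) {𝔟 : W.IdealSheafData} {ℓ ν : ℕ}
    (hνℓ : ν ≤ ℓ) (h𝔟 : 𝔟 ≤ C.comap k ^ ν) :
    (controlledTransform π C (𝔟.comap r ⊔ N * k.ker ^ ℓ) ν).comap (retractLiftOpen π C k r).ι =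
      (controlledTransform ρ (C.comap k) 𝔟 ν).comap (hπ.retractLift hρ hkr hCk) ⊔
        (N.comap π * C.comap π ^ (ℓ - ν) * (hπ.strictTransformHom hρ).ker ^ ℓ).comap
          (retractLiftOpen π C k r).ι := by
  rw [hπ.ker_strictTransformHom_of_isRegular hX hC hρ hCk hW]
  exact comap_controlledTransform_retract_mixed hπ hρ hkr hCk N hνℓ h𝔟

/-- **Monomial contact with the strict transform, regular case**: `π^*N · 𝓘(exc)^{ℓ-ν} · (ker Bl_C(k))^ℓ ≤
σᶜ_π(r^*𝔟 ⊔ N·𝓘_W^ℓ, ν)` on all of `X'`. [cite: BierstoneGrigorievMilmanWlodarczyk2011, §4 Remark (3) with §3.2 Lemma 3.2.1] -/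
theorem mul_pow_ker_strictTransformHom_le_mixed_of_isRegular (hX : Scheme.IsRegular X) (hπ : IsBlowup π C)
    (hρ : IsBlowup ρ (C.comap k)) (hkr : k ≫ r = 𝟙 W) (hCk : k.ker ≤ C) (hC : Scheme.IsRegular C.subscheme)
    (hW : Scheme.IsRegular k.ker.subscheme) (N : X.IdealSheafData) {𝔟 : W.IdealSheafData} {ℓ ν : ℕ}
    (hνℓ : ν ≤ ℓ) (h𝔟 : 𝔟 ≤ C.comap k ^ ν) :
    N.comap π * C.comap π ^ (ℓ - ν) * (hπ.strictTransformHom hρ).ker ^ ℓ ≤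
      controlledTransform π C (𝔟.comap r ⊔ N * k.ker ^ ℓ) ν := by
  rw [hπ.ker_strictTransformHom_of_isRegular hX hC hρ hCk hW]
  exact mul_pow_controlledTransform_ker_le_mixed hπ hkr hCk N hνℓ h𝔟

end RetractionMixed

end Summit.ResolutionOfSingularities.ResolutionOfSingularities.Theorems

end
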